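import Summits.QuantumAdvantage.QuantumAdvantage.Theses.ShorLocallyDark

/-!
# Route `ShorLocallyDark`: the `Assembly` item (stmt-QuantumAdvantage-10594)

The assembly item of route `ShorLocallyDark` is pure logic: `ClosureThesis` (`BQP ⊆ BPP`) contradicts `QuantumAdvantage = ∃ L ∈ BQP, L ∉ BPP` (the route's deciding theorem `closes` uses only this).
HONEST FRAMING (block-2b rule): a closed ledger item (settled-trivial), NOT summit progress — the route's
cruxes are untouched.
-/

set_option linter.dupNamespace false -- D-0017: single-problem summit ⇒ `QuantumAdvantage.QuantumAdvantage` by design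

namespace Summit.QuantumAdvantage.QuantumAdvantage.Theorems.ShorLocallyDark

/-- **`ShorLocallyDark.Assembly`** (stmt-QuantumAdvantage-10594): pure logic. [folklore] -/
theorem Assembly_proof : Summit.QuantumAdvantage.QuantumAdvantage.Theses.ShorLocallyDark.Assembly := by
  unfold Summit.QuantumAdvantage.QuantumAdvantage.Theses.ShorLocallyDark.Assembly
  exact fun h0 hQA => Exists.elim hQA fun _L hL => absurd (h0 hL.1) hL.2

end Summit.QuantumAdvantage.QuantumAdvantage.Theorems.ShorLocallyDark
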